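import Literature.MathematicalPhysics.QuantumFieldTheory.Balaban1983to89.B8LeafKnitZd3
import Literature.MathematicalPhysics.QuantumFieldTheory.Balaban1983to89.B8LeafSocketsB9
import Literature.MathematicalPhysics.QuantumFieldTheory.Balaban1983to89.B8LeafModelZd3Thm2Of135

/-!
# `Balaban1983to89.B8LeafKnitZd3B9All` — [Balaban1985RegularSpaces] the N05 knit `B8LeafKnitZd3.b8LeafRS_zd3_univ` RE-RUN WITH THE
# IN-EDGE b9 AS ONE HYPOTHESIS: «`∀ m ≤ k, SockB9P3 … m …`» ([4] Thm 3.3 in Proposition 3's frame at EVERY truncation level) — the exact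
# output shape of the N06 supplier (`pub-ymgap-dag-n06-b` `B9SupplySockB9P3Zd.sockB9P3_allLevels_of_thm33`) — in place of the two b9
# sockets `SockH59` (Theorem 4's frame) and `SockB9P3` (Proposition 3's frame, top level); and THEOREM 2 AS PRINTED under the same hypotheses

statement-level skeleton of published theorems with citation tags; proofs where landed; nothing here is a claim about the
Yang–Mills mass gap

PDF held: `paper:balaban1985-cmp99-regular-spaces-gauge-fixing` (journal page = PDF page + 74); pp. 79, 83, 86–88, 94, 99–101.

WHY THIS FILE (cell `pub-ymgap`, seat `pub-ymgap-dag-n05-a` g6, KNIT seat of DAG node N05 = [B8]; count-neutral).  g5 located (file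
`B8LeafSocketsB9`, ref-A g8-15) that Theorem 4's level-`m` b9 socket `SockH59` IS a `SockB9P3` datum at level `m` and that ONE statement per
member — `∀ m ≤ k, SockB9P3 L B₀ B₀β cP β len η m Ω Λs Λb` — serves both frames (`sockH59_of_allLevels`, `sockB9P3_of_allLevels`); dag-lead
(WORDS-94) made it the junction target J-N06→N05 and the N06 hand types exactly that shape.  This file re-runs the knit on it: the leaf
`B8LeafRS … famUniv …` with `l1 t2 p3 t4` discharged by the kernel instances of the prototype, modulo **four** named sockets (`SockHFP₀`,
`SockHFP` — Prop. 5's fixed point, n19-b's `sockHFP_of_letters` in progress; `SockP5u` — Prop. 5's uniqueness; `SB9all` — the in-edge b9)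
and the five remaining printed statements `p5e p5u p6 p7 t8`; and records THEOREM 2 AS PRINTED ((1.35) on Λ_j, chair R453 (C)) under the
same four sockets (`thm2_of135_zd3_univ_b9all`).

WHAT IS PROVED (kernel, 0 sorry, theorems only): **`b8LeafRS_zd3_univ_b9all`**, **`thm2_of135_zd3_univ_b9all`**.

HONEST SCOPE.  Bookkeeping BY NAME over `b8LeafRS_zd3_univ`, `sockH59_of_allLevels`, `sockB9P3_of_allLevels`, `thm2_of135_zd3_univ`; no
estimate proved; not a discharge of N05 (family pinned by NODE 00 as `famB8OfRecord`, but five conjuncts and four sockets remain open);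
count-neutral; nothing continuum / ℝ⁴ / OS / mass-gap / Clay.  Unit `pub-ymgap-dag-n05-a` (g6), 2026-08-26.
-/

noncomputable section

namespace Literature.MathematicalPhysics.QuantumFieldTheory.Balaban1983to89.B8LeafKnitZd3B9All

open B7Prop1Explicit B7Prop2Explicit B7Prop1Local
open B8Ineq132 (InAk BondTouches Under)
open B8Lemma1NonAbelian (mulCfg blockPairNA)
open B8Ineq130 (tlo thi)
open B8LeafKnitRS (B8LeafRS)
open B8LeafModelZd (SockP5u ZdIdx)
open B8LeafModelZdOfHFP (SockHFP₀ SockHFP)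
open B8LeafModelZd3 (zdGF3 SockB9P3)
open B8LeafSocketsB9 (sockH59_of_allLevels sockB9P3_of_allLevels)
open B8LeafKnitZd3 (b8LeafRS_zd3_univ)
open B8LeafModelZd3Thm2Of135 (thm2_of135_zd3_univ)

-- `Site` alone could resolve to the torus sites of `Setup.lean`; re-export the `ℤ^d` sites of `B7Prop1Explicit`.
export B7Prop1Explicit (Site)

variable {d : ℕ}

section Knit

variable {𝔸 : Type} [CStarAlgebra 𝔸] [Nontrivial 𝔸]
variable {I₃ I₄ : Type} {lan : I₃ → B8.LandauData} {cub : I₄ → B8.CubeData}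

/-- **THE RE-TYPED B8 LEAF AT THE PROTOTYPE, b9 AS ONE ALL-LEVELS SOCKET**: `B8LeafKnitZd3.b8LeafRS_zd3_univ` with its two b9 sockets
(`SockH59` at threshold `min cB9 (cB9/K₀)`, `K₀ = 2L·5dLB₀ + 8·8B₀′·5dLB₀`, and `SockB9P3` at `cB9`) served from ONE hypothesis per member,
`SB9all : ∀ m ≤ k, SockB9P3 L B₀ B₀β cB9 β len η m Ω Λs Λb` (the N06 supplier's output shape), by `B8LeafSocketsB9.sockH59_of_allLevels` /
`sockB9P3_of_allLevels`.  Remaining hypotheses: `SockHFP₀`/`SockHFP` (Prop. 5 fixed point), `SockP5u` (Prop. 5 uniqueness), and the printed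
statements `p5e p5u p6 p7 t8`. [cite: Balaban1985RegularSpaces, Lemma 1 p.79, Thm 2 p.83, Prop. 3 p.87, Thm 4 p.88, (1.59) p.86; Prop. 5 p.94, Prop. 6 p.99, Prop. 7 p.100, Thm 8 p.101 (named hypotheses)] -/
theorem b8LeafRS_zd3_univ_b9all (hd2 : 2 ≤ d) {L : ℕ} (hL : 2 ≤ L) (Lb : ℕ) (β : ℝ) (len : Site d → ℝ) (inp : B8.B9Inputs)
    {B₀β C₂ cu cF₀ cF cu' cB9 B₁ B₂ c₁ : ℝ} (hB : 2 ≤ 5 * (d : ℝ) * L * inp.B₀) (hB₀β : 0 < B₀β)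
    (hC₂ : 2097152 * ((d : ℝ) + 1) ^ 2 ≤ C₂) (hcu : 0 < cu) (hcF₀ : 0 < cF₀) (hcF : 0 < cF) (hcu' : 0 < cu') (hcB9 : 0 < cB9)
    (SHFP₀ : ∀ i : ZdIdx d L, SockHFP₀ (𝔸 := 𝔸) L inp.B₀ inp.B₀' cF₀ i.η i.k i.Ω i.Λs)
    (SHFP : ∀ i : ZdIdx d L, SockHFP (𝔸 := 𝔸) L inp.B₀ inp.B₀' cF i.η i.k i.Ω i.Λs)
    (SP5u : ∀ i : ZdIdx d L, SockP5u (𝔸 := 𝔸) L cu' cu i.η i.k i.Ω i.Λs)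
    (SB9all : ∀ i : ZdIdx d L, ∀ m, m ≤ i.k → SockB9P3 (𝔸 := 𝔸) L inp.B₀ B₀β cB9 β len i.η m i.Ω i.Λs i.Λb)
    {toAxial : ∀ i : {i : ZdIdx d L // i.Ω 0 = Set.univ}, (zdGF3 𝔸 L β len i.1).Cfg → (zdGF3 𝔸 L β len i.1).Pert →
      (zdGF3 𝔸 L β len i.1).Pert}
    (p5e : B8.Prop5Exists inp.B₀' B₁ lan) (p5u : B8.Prop5Unique lan) (p6 : B8.Prop6Printed d (L : ℝ) B₁ c₁ cub)
    (p7 : B8SectGH.Prop7PrintedR (fun i : {i : ZdIdx d L // i.Ω 0 = Set.univ} => zdGF3 𝔸 L β len i.1) toAxial)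
    (t8 : B8Thm8Surviving.Thm8SurvivingAt 1 B₁ B₂ (fun i : {i : ZdIdx d L // i.Ω 0 = Set.univ} => zdGF3 𝔸 L β len i.1)) :
    B8LeafRS d (L : ℝ) C₂ (5 * (d : ℝ) * L * inp.B₀) inp.B₀' B₁ B₂ c₁ inp B₀β (blockPairNA d Lb 𝔸)
      (fun i : {i : ZdIdx d L // i.Ω 0 = Set.univ} => zdGF3 𝔸 L β len i.1) lan cub toAxial := by
  have hd1 : 1 ≤ d := le_trans (by norm_num) hd2
  have hL1 : 1 ≤ L := le_trans (by norm_num) hL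
  have hd' : (1 : ℝ) ≤ d := by exact_mod_cast hd1
  have hL' : (1 : ℝ) ≤ L := by exact_mod_cast hL1
  have hB₀ := inp.B₀_pos
  have hB₀' := inp.B₀'_pos
  -- Theorem 4's b9 socket below `min cB9 (cB9 / K₀)`
  have hK₀ : 0 < 2 * (L * (5 * (d : ℝ) * L * inp.B₀)) + 8 * (8 * inp.B₀' * (5 * (d : ℝ) * L * inp.B₀)) := by positivity
  have hc59 : 0 < min cB9 (cB9 / (2 * (L * (5 * (d : ℝ) * L * inp.B₀)) + 8 * (8 * inp.B₀' * (5 * (d : ℝ) * L * inp.B₀)))) :=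
    lt_min hcB9 (div_pos hcB9 hK₀)
  exact b8LeafRS_zd3_univ hd2 hL Lb β len inp hB hB₀β hC₂ hcu hcF₀ hcF hc59 hcu' hcB9 SHFP₀ SHFP
    (fun i => sockH59_of_allLevels hd1 hL1 hB₀ hB₀'.le hcB9 (SB9all i)) SP5u (fun i => sockB9P3_of_allLevels (SB9all i))
    p5e p5u p6 p7 t8

/-- **THEOREM 2 AS PRINTED ((1.35) on Λ_j) on the `Ω₀ = ℤᵈ` sub-family, b9 AS ONE ALL-LEVELS SOCKET**: `B8LeafModelZd3Thm2Of135.thm2_of135_zd3_univ`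
(chair R453 (C)) with its two b9 sockets served from `SB9all` as above. [cite: Balaban1985RegularSpaces, Thm 2 p.83, (1.35) p.82, (1.65) p.87, (1.59) p.86] -/
theorem thm2_of135_zd3_univ_b9all (hd2 : 2 ≤ d) {L : ℕ} (hL : 2 ≤ L) {β : ℝ} {len : Site d → ℝ}
    {B₀ B₀' B₀β cu cF₀ cF cu' cB9 : ℝ} (hB₀ : 0 < B₀) (hB₀' : 0 < B₀') (hB₀β : 0 < B₀β) (hB : 2 ≤ 5 * (d : ℝ) * L * B₀)
    (hcu : 0 < cu) (hcF₀ : 0 < cF₀) (hcF : 0 < cF) (hcu' : 0 < cu') (hcB9 : 0 < cB9)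
    (SHFP₀ : ∀ i : ZdIdx d L, SockHFP₀ (𝔸 := 𝔸) L B₀ B₀' cF₀ i.η i.k i.Ω i.Λs)
    (SHFP : ∀ i : ZdIdx d L, SockHFP (𝔸 := 𝔸) L B₀ B₀' cF i.η i.k i.Ω i.Λs)
    (SP5u : ∀ i : ZdIdx d L, SockP5u (𝔸 := 𝔸) L cu' cu i.η i.k i.Ω i.Λs)
    (SB9all : ∀ i : ZdIdx d L, ∀ m, m ≤ i.k → SockB9P3 (𝔸 := 𝔸) L B₀ B₀β cB9 β len i.η m i.Ω i.Λs i.Λb) :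
    ∃ B₁ B₂ c₁ : ℝ, 0 < B₁ ∧ 0 < B₂ ∧ 0 < c₁ ∧
      ∀ i : {i : ZdIdx d L // i.Ω 0 = Set.univ},
        (∀ ℓ, ℓ ≤ i.1.k → ∀ w : Site d, (∀ x, InBox (tlo L w ℓ) (thi L w ℓ) x → x ∈ i.1.Ω ℓ) →
          ∃ j, ℓ ≤ j ∧ j ≤ i.1.k ∧ ∃ y ∈ i.1.Λs i.1.k j, Under L (j - ℓ) y w) →
        ∀ α₀ α₁ : ℝ, 0 < α₀ → 0 < α₁ → α₀ + α₁ ≤ c₁ →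
          ∀ (U₀ : (zdGF3 𝔸 L β len i.1).Cfg) (P : (zdGF3 𝔸 L β len i.1).Pert),
            (zdGF3 𝔸 L β len i.1).InA α₀ U₀ → (zdGF3 𝔸 L β len i.1).Reg335 α₀ U₀ → (zdGF3 𝔸 L β len i.1).InAAx α₀ U₀ P →
            (∀ j, j ≤ i.1.k → ∀ (z : Site d) (μ : Fin d), BondTouches (i.1.Λs i.1.k j) z μ →
              (∀ x, InBox (loK L j z) (bondHiK L j z μ) x → x ∈ i.1.Ω j) →
              ‖(avgIter L (mulCfg P.2.1 U₀.1) j z μ : 𝔸) - (avgIter L U₀.1 j z μ : 𝔸)‖ ≤ α₁) →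
            ∃ u : (zdGF3 𝔸 L β len i.1).GT, (zdGF3 𝔸 L β len i.1).Restricted U₀ u ∧
              ((zdGF3 𝔸 L β len i.1).C136 B₁ B₂ (α₀ + (11 * (d : ℝ) ^ 2 * α₀ + α₁)) U₀ ((zdGF3 𝔸 L β len i.1).act P u) ∧
                (zdGF3 𝔸 L β len i.1).C137 α₁ U₀ ((zdGF3 𝔸 L β len i.1).act P u) ∧
                (zdGF3 𝔸 L β len i.1).Landau U₀ ((zdGF3 𝔸 L β len i.1).act P u) ∧
                (zdGF3 𝔸 L β len i.1).C139 B₁ (α₀ + (11 * (d : ℝ) ^ 2 * α₀ + α₁)) U₀ ((zdGF3 𝔸 L β len i.1).act P u)) ∧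
              ∀ u' : (zdGF3 𝔸 L β len i.1).GT, (zdGF3 𝔸 L β len i.1).Restricted U₀ u' →
                (zdGF3 𝔸 L β len i.1).C136 B₁ B₂ (α₀ + (11 * (d : ℝ) ^ 2 * α₀ + α₁)) U₀ ((zdGF3 𝔸 L β len i.1).act P u') →
                (zdGF3 𝔸 L β len i.1).C137 α₁ U₀ ((zdGF3 𝔸 L β len i.1).act P u') →
                (zdGF3 𝔸 L β len i.1).Landau U₀ ((zdGF3 𝔸 L β len i.1).act P u') →
                (zdGF3 𝔸 L β len i.1).C139 B₁ (α₀ + (11 * (d : ℝ) ^ 2 * α₀ + α₁)) U₀ ((zdGF3 𝔸 L β len i.1).act P u') →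
                  u' = u := by
  have hd1 : 1 ≤ d := le_trans (by norm_num) hd2
  have hL1 : 1 ≤ L := le_trans (by norm_num) hL
  have hd' : (1 : ℝ) ≤ d := by exact_mod_cast hd1
  have hL' : (1 : ℝ) ≤ L := by exact_mod_cast hL1
  have hK₀ : 0 < 2 * (L * (5 * (d : ℝ) * L * B₀)) + 8 * (8 * B₀' * (5 * (d : ℝ) * L * B₀)) := by positivity
  have hc59 : 0 < min cB9 (cB9 / (2 * (L * (5 * (d : ℝ) * L * B₀)) + 8 * (8 * B₀' * (5 * (d : ℝ) * L * B₀)))) :=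
    lt_min hcB9 (div_pos hcB9 hK₀)
  exact thm2_of135_zd3_univ hd2 hL hB₀ hB₀' hB₀β hB hcu hcF₀ hcF hc59 hcu' hcB9 SHFP₀ SHFP
    (fun i => sockH59_of_allLevels hd1 hL1 hB₀ hB₀'.le hcB9 (SB9all i)) SP5u (fun i => sockB9P3_of_allLevels (SB9all i))

end Knit

#print axioms b8LeafRS_zd3_univ_b9all
#print axioms thm2_of135_zd3_univ_b9all

end Literature.MathematicalPhysics.QuantumFieldTheory.Balaban1983to89.B8LeafKnitZd3B9All

end
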